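import Mathlib
import Literature.RingTheory.FormalGroups.HochschildFormulaProofs
import Literature.AlgebraicGeometry.Resolution.RegularDerivationQuotient
import Literature.AlgebraicGeometry.Resolution.AlterationsNodalMonomialization
import HarnessLib

/-!
# Crux `LogCanQuotLU` (stmt-ResolutionOfSingularities-17082), line `birth`: the twisted root algebra

Route `ResolutionOfSingularities/FoliationDescent`, stub `stub_twistedRootAlgebra` of the lead's skeleton
(`Cruxes/LogCanQuotLU/Lines/birth.lean`, RESHAPE 2), PROVED (statement verbatim from the registration).

**Setting.** `k` of characteristic `p`, `K ⊇ k` a field, `T ≤ K` finitely generated and a regular ring,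
`E` a `k`-derivation of `K` with `E(T) ⊆ T`, `E^[p] = u·E`, `u, u⁻¹ ∈ T`, `E u = 0` (the MULTIPLICATIVE
case of the crux after shrinking), `C = T ∩ ker E`. **Statement.** There are a finite-type regular
`k`-algebra `S` and a `k`-derivation `θ` of `S` with `θ^[p] = θ` such that `ker θ` is an étale
`C`-algebra (compatibly with `k`) lying over every prime of `C`.

**Proof** (`twistedRootAlgebra_core`, abstract in `R := T` and `j : C → R`). `f := X^{p-1} - u⁻¹`
(monic, `f' = -X^{p-2}` since `p - 1 = -1`, `(-uX)·f' + (-u)·f = 1`), `S := R[X]/(f)` (regular: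
Stacks 07PG companion `isRegularRing_adjoinRoot_of_isCoprime_derivative`; finite type). `E|_R` extends
to `R[X]` coefficientwise (`Θ X = 0`), kills `f`, and descends to `E_S` (`Derivation.quotientLift`). For
`ω` the class of `X` (`ω^{p-1} = u⁻¹`, a unit), `θ := ω • E_S` has `θ^p = ω^p E_S^p + θ^{p-1}(ω) E_S
= ω^p u E_S = θ` (Hochschild). `ker θ = ker E_S` = classes of polynomials with constant coefficients =
the image of the injective `AdjoinRoot (X^{p-1} - u⁻¹ : C[X]) → S` (division by the monic `f` commutes
with coefficient maps), which is standard étale over `C` (Mathlib `StandardEtalePair`, `g = 1`) and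
finite free of rank `p - 1 ≥ 1`, hence lying over every prime.

Sources: Rudakov–Shafarevich 1976 §1–2 (multiplicative derivations = `μ_p`-actions); Bergh–Rydh 2019,
definition before Thm 5. Mathlib: `AdjoinRoot`, `StandardEtalePair`, `Polynomial.modByMonic`/`lifts`;
in-tree: Hochschild (`Literature.RingTheory.FormalGroups`), Stacks 07PG, `Derivation.quotientLift`.
-/

set_option linter.dupNamespace false

noncomputable section

open Polynomial Function

namespace Summit.ResolutionOfSingularities.ResolutionOfSingularities.Theorems

namespace TwistedRootAlgebra

/-! ## Restricting a derivation of `K` to a stable subalgebra -/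

/-- A `k`-derivation of `K` preserving a subalgebra `T` restricts to a `k`-derivation of `T`.
[folklore] -/
theorem exists_derivation_restrict {k K : Type} [Field k] [Field K] [Algebra k K]
    (T : Subalgebra k K) (E : Derivation k K K) (hpres : ∀ x ∈ T, E x ∈ T) :
    ∃ ER : Derivation k T T, ∀ z : T, ((ER z : T) : K) = E z := by
  let φ : T →ₗ[k] T :=
    { toFun := fun z => ⟨E z, hpres z z.2⟩
      map_add' := fun a b => Subtype.ext (by simp)
      map_smul' := fun c a => Subtype.ext (by simp) }
  refine ⟨Derivation.mk' φ fun a b => Subtype.ext ?_, fun z => rfl⟩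
  change E ((a : K) * b) = ((a • (⟨E b, hpres b b.2⟩ : T) + b • (⟨E a, hpres a a.2⟩ : T) : T) : K)
  rw [Derivation.leibniz]
  simp

/-! ## Coefficientwise extension of a derivation to the polynomial ring, killing `X` -/

/-- A derivation `θ` of `A` extends to `A[X]` coefficientwise: `Θ (Σ aₙ Xⁿ) = Σ θ(aₙ) Xⁿ`
(`Θ X = 0`). [folklore] -/
theorem exists_derivation_polynomial_X {R A : Type*} [CommRing R] [CommRing A] [Algebra R A]
    (θ : Derivation R A A) :
    ∃ Θ : Derivation R A[X] A[X], ∀ (q : A[X]) (n : ℕ), (Θ q).coeff n = θ (q.coeff n) := by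
  classical
  let L : A[X] →ₗ[R] A[X] :=
    Polynomial.lsum fun n => ((monomial n : A →ₗ[A] A[X]).restrictScalars R) ∘ₗ θ.toLinearMap
  have hL : ∀ f : A[X], L f = f.sum fun n a => monomial n (θ a) := fun f => by
    simp [L, Polynomial.lsum_apply]
  have hLcoeff : ∀ (f : A[X]) (m : ℕ), (L f).coeff m = θ (f.coeff m) := by
    intro f m
    rw [hL, Polynomial.sum_def, finsetSum_coeff]
    simp_rw [coeff_monomial]
    rw [Finset.sum_ite_eq']
    split_ifs with h
    · rfl
    · rw [notMem_support_iff.mp h, map_zero]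
  have hLmul : ∀ f g : A[X], L (f * g) = f * L g + g * L f := by
    intro f g
    ext m
    rw [hLcoeff, coeff_add, coeff_mul, map_sum, coeff_mul, mul_comm g, coeff_mul,
      ← Finset.sum_add_distrib]
    refine Finset.sum_congr rfl fun x _ => ?_
    rw [Derivation.leibniz, smul_eq_mul, smul_eq_mul, hLcoeff, hLcoeff]
    ring
  exact ⟨Derivation.mk' L fun f g => by rw [hLmul, smul_eq_mul, smul_eq_mul], fun q n => by
    rw [Derivation.coe_mk', hLcoeff]⟩

/-- Iterates of the coefficientwise extension act coefficientwise. [folklore] -/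
theorem coeff_iterate_of_coeff {R A : Type*} [CommRing R] [CommRing A] [Algebra R A]
    (θ : Derivation R A A) (Θ : Derivation R A[X] A[X])
    (hΘ : ∀ (q : A[X]) (n : ℕ), (Θ q).coeff n = θ (q.coeff n)) (j : ℕ) (q : A[X]) (n : ℕ) :
    ((⇑Θ)^[j] q).coeff n = (⇑θ)^[j] (q.coeff n) := by
  induction j generalizing q with
  | zero => rfl
  | succ j ih => rw [iterate_succ_apply, iterate_succ_apply, ih, hΘ]

/-- Iterates of a derivation kill `0`. [folklore] -/
theorem iterate_apply_zero {R A : Type*} [CommRing R] [CommRing A] [Algebra R A]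
    (θ : Derivation R A A) : ∀ n : ℕ, (⇑θ)^[n] 0 = 0
  | 0 => rfl
  | n + 1 => by rw [iterate_succ_apply, map_zero, iterate_apply_zero θ n]

/-- Coercion of iterates of the restricted derivation. [folklore] -/
theorem coe_iterate_restrict {k K : Type} [Field k] [Field K] [Algebra k K]
    (T : Subalgebra k K) (E : Derivation k K K) (ER : Derivation k T T)
    (hER : ∀ z : T, ((ER z : T) : K) = E z) (n : ℕ) (z : T) :
    (((⇑ER)^[n] z : T) : K) = (⇑E)^[n] z := by
  induction n generalizing z with
  | zero => rfl
  | succ n ih => rw [iterate_succ_apply, iterate_succ_apply, ih, hER]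

end TwistedRootAlgebra

open TwistedRootAlgebra Literature.AlgebraicGeometry.Resolution in
/-- **Core of the twisted root algebra** (abstract form): for a finite-type regular `k`-algebra `R`
of characteristic `p`, a `k`-derivation `E_R` of `R` with `E_R^[p] = u · E_R`, `u v = 1`, `E_R u = 0`,
and an injective `k`-algebra map `j : C₀ → R` whose range is exactly the ring of constants of `E_R`,
the algebra `S = R[X]/(X^{p-1} - v)` with `θ = ω • E_S` has `θ^[p] = θ`, and `ker θ` is an étale
`C₀`-algebra lying over every prime of `C₀`. See the module docstring. [folklore] -/
theorem twistedRootAlgebra_core (p : ℕ) [Fact p.Prime] (k : Type) [Field k] [CharP k p]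
    (R : Type) [CommRing R] [IsDomain R] [Algebra k R] [Algebra.FiniteType k R] [IsRegularRing R]
    [CharP R p] (ER : Derivation k R R) (uR vR : R) (huv : uR * vR = 1)
    (hmul : ∀ z : R, (⇑ER)^[p] z = uR * ER z) (hERu : ER uR = 0)
    (C₀ : Type) [CommRing C₀] [IsDomain C₀] [Algebra k C₀] [CharP C₀ p] (j : C₀ →ₐ[k] R)
    (hj : Function.Injective j) (hjC : ∀ z : R, ER z = 0 ↔ z ∈ Set.range j) :
    ∃ (S : Type) (_ : CommRing S) (_ : Algebra k S), Algebra.FiniteType k S ∧ IsRegularRing S ∧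
      ∃ θ : Derivation k S S, (∀ s : S, (⇑θ)^[p] s = θ s) ∧
        ∀ Z : Subalgebra k S, (∀ s : S, s ∈ Z ↔ θ s = 0) →
          ∃ (_ : Algebra C₀ Z) (_ : IsScalarTower k C₀ Z), Algebra.Etale C₀ Z ∧
            ∀ P : Ideal C₀, P.IsPrime →
              ∃ Q : Ideal Z, Q.IsPrime ∧ Q.comap (algebraMap C₀ Z) = P := by
  classical
  have hp : p.Prime := Fact.out
  have hp2 : 2 ≤ p := hp.two_le
  have hvu : vR * uR = 1 := by rw [mul_comm, huv]
  have hERv : ER vR = 0 := by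
    have h := congrArg ER huv
    rw [Derivation.leibniz, Derivation.map_one_eq_zero, hERu, smul_zero, add_zero, smul_eq_mul] at h
    calc ER vR = vR * (uR * ER vR) := by rw [← mul_assoc, hvu, one_mul]
      _ = 0 := by rw [h, mul_zero]
  -- the polynomial `f = X^(p-1) - v`
  obtain ⟨f, hfdef⟩ : ∃ f : R[X], f = X ^ (p - 1) - Polynomial.C vR := ⟨_, rfl⟩
  have hf : f.Monic := hfdef ▸ monic_X_pow_sub_C vR (by omega)
  have hfdeg : f.natDegree = p - 1 := by rw [hfdef]; exact natDegree_X_pow_sub_C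
  have hf1 : f ≠ 1 := fun h => by
    have := congrArg natDegree h
    rw [hfdeg, natDegree_one] at this
    omega
  -- the quotient `S = R[X]/(f)` (definitionally `AdjoinRoot f`)
  haveI hSnt : Nontrivial (R[X] ⧸ Ideal.span {f}) :=
    Ideal.Quotient.nontrivial_iff.mpr
      (Ideal.span_singleton_ne_top fun h => hf1 (hf.eq_one_of_isUnit h))
  haveI : CharP (R[X] ⧸ Ideal.span {f}) p :=
    charP_of_injective_algebraMap (algebraMap k (R[X] ⧸ Ideal.span {f})).injective p
  have hSft : Algebra.FiniteType k (R[X] ⧸ Ideal.span {f}) :=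
    inferInstanceAs (Algebra.FiniteType k (AdjoinRoot f))
  have hSreg : IsRegularRing (R[X] ⧸ Ideal.span {f}) := by
    have hcop : IsCoprime f (derivative f) := by
      have hder : derivative f = -X ^ (p - 2) := by
        rw [hfdef, derivative_sub, derivative_X_pow, derivative_C, sub_zero,
          Nat.cast_sub (by omega : 1 ≤ p), CharP.cast_eq_zero, Nat.cast_one, zero_sub,
          show p - 1 - 1 = p - 2 by omega, C_neg, C_1, neg_one_mul]
      have hx : (X : R[X]) ^ (p - 2) * X = X ^ (p - 1) := by
        rw [← pow_succ]; congr 1; omega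
      have h1 : Polynomial.C vR * Polynomial.C uR = (1 : R[X]) := by rw [← C_mul, hvu, C_1]
      refine ⟨-Polynomial.C uR, -Polynomial.C uR * X, ?_⟩
      rw [hder, hfdef]
      linear_combination h1 + Polynomial.C uR * hx
    exact isRegularRing_adjoinRoot_of_isCoprime_derivative f hcop
  -- the coefficientwise extension `Θ` of `ER` and its descent `ES` to `S`
  obtain ⟨Θ, hΘ⟩ := exists_derivation_polynomial_X ER
  have hΘf : Θ f = 0 := by
    ext n
    rw [hΘ, hfdef, coeff_sub, coeff_X_pow, coeff_C, coeff_zero, map_sub]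
    split_ifs <;> simp [hERv]
  have hfI : f ∈ Ideal.span {f} := Ideal.mem_span_singleton_self f
  have hf0 : Ideal.Quotient.mk (Ideal.span {f}) f = 0 := Ideal.Quotient.eq_zero_iff_mem.mpr hfI
  have hDI : ∀ x ∈ Ideal.span {f},
      ((Algebra.linearMap R[X] (R[X] ⧸ Ideal.span {f})).compDer Θ) x = 0 := by
    intro x hx
    obtain ⟨q, rfl⟩ := Ideal.mem_span_singleton'.mp hx
    change Ideal.Quotient.mk (Ideal.span {f}) (Θ (q * f)) = 0
    rw [Derivation.leibniz, hΘf, smul_zero, zero_add, smul_eq_mul, map_mul, hf0]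
    exact zero_mul _
  obtain ⟨ES, hES⟩ : ∃ ES : Derivation k (R[X] ⧸ Ideal.span {f}) (R[X] ⧸ Ideal.span {f}),
      ∀ q : R[X], ES (Ideal.Quotient.mk _ q) = Ideal.Quotient.mk _ (Θ q) :=
    ⟨Derivation.quotientLift (Ideal.span {f}) _ hDI, fun q => by
      rw [Derivation.quotientLift_mk]; rfl⟩
  have hESiter : ∀ (n : ℕ) (q : R[X]),
      (⇑ES)^[n] (Ideal.Quotient.mk _ q) = Ideal.Quotient.mk _ ((⇑Θ)^[n] q) := by
    intro n
    induction n with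
    | zero => intro q; rfl
    | succ n ih => intro q; rw [iterate_succ_apply, iterate_succ_apply, hES, ih]
  have hΘp : ∀ q, (⇑Θ)^[p] q = Polynomial.C uR * Θ q := fun q => by
    ext n
    rw [coeff_iterate_of_coeff ER Θ hΘ, coeff_C_mul, hΘ, hmul]
  have hESp : ∀ s, (⇑ES)^[p] s = Ideal.Quotient.mk _ (Polynomial.C uR) * ES s := fun s => by
    obtain ⟨q, rfl⟩ := Ideal.Quotient.mk_surjective s
    rw [hESiter, hΘp, map_mul, hES]
  have hΘX : Θ X = 0 := by
    ext n
    rw [hΘ, coeff_X, coeff_zero]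
    split_ifs <;> simp
  -- `ω`, the class of `X`: `ω^(p-1) = v`, a unit
  obtain ⟨ω, hωdef⟩ : ∃ ω : R[X] ⧸ Ideal.span {f}, ω = Ideal.Quotient.mk _ X := ⟨_, rfl⟩
  have hESω : ES ω = 0 := by rw [hωdef, hES, hΘX, map_zero]
  have hωpow : ω ^ (p - 1) = Ideal.Quotient.mk _ (Polynomial.C vR) := by
    have h0 : Ideal.Quotient.mk (Ideal.span {f}) (X ^ (p - 1) - Polynomial.C vR) = 0 := by
      rw [← hfdef]; exact hf0
    rw [map_sub, map_pow, sub_eq_zero, ← hωdef] at h0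
    exact h0
  have hvSuS : Ideal.Quotient.mk (Ideal.span {f}) (Polynomial.C vR) *
      Ideal.Quotient.mk _ (Polynomial.C uR) = 1 := by
    rw [← map_mul, ← C_mul, hvu, C_1, map_one]
  have hωunit : IsUnit ω := by
    refine IsUnit.of_mul_eq_one (ω ^ (p - 2) * Ideal.Quotient.mk _ (Polynomial.C uR)) ?_
    rw [← mul_assoc, ← pow_succ', show p - 2 + 1 = p - 1 by omega, hωpow, hvSuS]
  -- `θ := ω • ES` satisfies `θ^p = θ` (Hochschild)
  have hθω : (⇑(ω • ES))^[p - 1] ω = 0 := by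
    rw [show p - 1 = p - 2 + 1 by omega, iterate_succ_apply, Derivation.smul_apply, smul_eq_mul,
      hESω, mul_zero, iterate_apply_zero]
  have hωp : ω ^ p = ω * Ideal.Quotient.mk _ (Polynomial.C vR) := by
    rw [← hωpow, ← pow_succ', show p - 1 + 1 = p by omega]
  have hθp : ∀ s, (⇑(ω • ES))^[p] s = (ω • ES) s := fun s => by
    rw [Literature.RingTheory.FormalGroups.iterate_prime_smul_apply p ES ω s, hESp, hθω, zero_mul,
      add_zero, Derivation.smul_apply, smul_eq_mul, hωp, mul_assoc ω, ← mul_assoc _ _ (ES s),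
      hvSuS, one_mul]
  refine ⟨R[X] ⧸ Ideal.span {f}, inferInstance, inferInstance, hSft, hSreg, ω • ES, hθp,
    fun Z hZ => ?_⟩
  -- the constants `Z = ker θ = ker ES`
  have hZ' : ∀ s, s ∈ Z ↔ ES s = 0 := fun s => by
    rw [hZ, Derivation.smul_apply, smul_eq_mul]
    exact ⟨fun h => hωunit.mul_right_eq_zero.mp h, fun h => by rw [h, mul_zero]⟩
  -- the unit and its inverse are constants
  obtain ⟨uC, huC⟩ := (hjC uR).mp hERu
  obtain ⟨vC, hvC⟩ := (hjC vR).mp hERv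
  have hvCuC : vC * uC = 1 := hj (by rw [map_mul, huC, hvC, hvu, map_one])
  have hj' : Function.Injective (j : C₀ →+* R) := hj
  -- `f_C = X^(p-1) - v ∈ C₀[X]`
  obtain ⟨fC, hfCdef⟩ : ∃ fC : C₀[X], fC = X ^ (p - 1) - Polynomial.C vC := ⟨_, rfl⟩
  have hfCmap : fC.map (j : C₀ →+* R) = f := by
    rw [hfCdef, hfdef, Polynomial.map_sub, Polynomial.map_pow, map_X, map_C, RingHom.coe_coe, hvC]
  have hfC : fC.Monic := hfCdef ▸ monic_X_pow_sub_C vC (by omega)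
  -- `ψ : AdjoinRoot f_C → S`, `X ↦ ω`
  have hψ0 : fC.eval₂ (((Ideal.Quotient.mk (Ideal.span {f})).comp Polynomial.C).comp
      (j : C₀ →+* R)) ω = 0 := by
    rw [← Polynomial.eval₂_map, hfCmap, hωdef, ← Polynomial.hom_eval₂, eval₂_C_X, hf0]
  have hψmk : ∀ q : C₀[X], AdjoinRoot.lift _ ω hψ0 (AdjoinRoot.mk fC q) =
      Ideal.Quotient.mk _ (q.map (j : C₀ →+* R)) := fun q => by
    rw [AdjoinRoot.lift_mk, ← Polynomial.eval₂_map, hωdef, ← Polynomial.hom_eval₂, eval₂_C_X]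
  have hΘmapC : ∀ q : C₀[X], Θ (q.map (j : C₀ →+* R)) = 0 := fun q => by
    ext n
    rw [hΘ, coeff_map, coeff_zero]
    exact (hjC _).mpr ⟨_, rfl⟩
  have hψZ : ∀ e, ES (AdjoinRoot.lift _ ω hψ0 e) = 0 := fun e => by
    induction e using AdjoinRoot.induction_on with
    | ih q => rw [hψmk, hES, hΘmapC, map_zero]
  have hψinj : Function.Injective (AdjoinRoot.lift _ ω hψ0) := by
    refine (injective_iff_map_eq_zero _).mpr fun e he => ?_
    induction e using AdjoinRoot.induction_on with
    | ih q =>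
      rw [hψmk, Ideal.Quotient.eq_zero_iff_mem, Ideal.mem_span_singleton,
        ← Polynomial.modByMonic_eq_zero_iff_dvd hf, ← hfCmap, ← Polynomial.map_modByMonic _ hfC,
        Polynomial.map_eq_zero_iff hj', Polynomial.modByMonic_eq_zero_iff_dvd hfC] at he
      exact AdjoinRoot.mk_eq_zero.mpr he
  have hψsurj : ∀ z ∈ Z, ∃ e, AdjoinRoot.lift _ ω hψ0 e = z := by
    intro z hz
    obtain ⟨q, rfl⟩ := Ideal.Quotient.mk_surjective z
    have hq : Ideal.Quotient.mk (Ideal.span {f}) (q %ₘ f) = Ideal.Quotient.mk _ q := by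
      rw [Ideal.Quotient.eq, Ideal.mem_span_singleton]
      refine ⟨-(q /ₘ f), ?_⟩
      have h := Polynomial.modByMonic_add_div q f
      linear_combination h
    rw [← hq, hZ', hES, Ideal.Quotient.eq_zero_iff_mem, Ideal.mem_span_singleton] at hz
    have hΘr : Θ (q %ₘ f) = 0 := by
      by_contra hne
      refine hf.not_dvd_of_natDegree_lt hne ?_ hz
      calc (Θ (q %ₘ f)).natDegree ≤ (q %ₘ f).natDegree :=
            Polynomial.natDegree_le_iff_coeff_eq_zero.mpr fun n hn => by
              rw [hΘ, Polynomial.coeff_eq_zero_of_natDegree_lt hn, map_zero]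
        _ < f.natDegree := Polynomial.natDegree_modByMonic_lt q hf hf1
    have hlift : q %ₘ f ∈ Polynomial.lifts (j : C₀ →+* R) := by
      refine (Polynomial.lifts_iff_coeff_lifts _).mpr fun n => (hjC _).mp ?_
      have h := congrArg (fun r : R[X] => r.coeff n) hΘr
      simpa only [hΘ, coeff_zero] using h
    obtain ⟨r, hr⟩ := (Polynomial.mem_lifts _).mp hlift
    exact ⟨AdjoinRoot.mk fC r, by rw [hψmk, hr, hq]⟩
  -- the ring isomorphism `AdjoinRoot f_C ≃ Z` and the `C₀`-algebra structure on `Z`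
  let ψZ : AdjoinRoot fC →+* Z :=
    (AdjoinRoot.lift _ ω hψ0).codRestrict Z fun e => (hZ' _).mpr (hψZ e)
  have hψZbij : Function.Bijective ψZ :=
    ⟨fun a b h => hψinj (congrArg Subtype.val h),
      fun z => by
        obtain ⟨e, he⟩ := hψsurj z.1 z.2
        exact ⟨e, Subtype.ext he⟩⟩
  let eZ : AdjoinRoot fC ≃+* Z := RingEquiv.ofBijective ψZ hψZbij
  have heZ : ∀ e, ((eZ e : Z) : R[X] ⧸ Ideal.span {f}) = AdjoinRoot.lift _ ω hψ0 e := fun e => rfl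
  letI alg : Algebra C₀ Z := (eZ.toRingHom.comp (algebraMap C₀ (AdjoinRoot fC))).toAlgebra
  have halg : ∀ c, algebraMap C₀ Z c = eZ (algebraMap C₀ (AdjoinRoot fC) c) := fun c => rfl
  haveI hIST : IsScalarTower k C₀ Z := by
    refine IsScalarTower.of_algebraMap_eq fun c => Subtype.ext ?_
    rw [halg, heZ, AdjoinRoot.algebraMap_eq, AdjoinRoot.lift_of]
    change algebraMap k (R[X] ⧸ Ideal.span {f}) c =
      Ideal.Quotient.mk _ (Polynomial.C ((j : C₀ →+* R) (algebraMap k C₀ c)))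
    rw [RingHom.coe_coe, AlgHom.commutes, ← Polynomial.algebraMap_apply, Ideal.Quotient.mk_algebraMap]
  let eC : AdjoinRoot fC ≃ₐ[C₀] Z := { eZ with commutes' := fun c => rfl }
  -- `AdjoinRoot f_C` is standard étale over `C₀`
  haveI : Algebra.Etale C₀ (AdjoinRoot fC) := by
    have hderC : derivative fC = -X ^ (p - 2) := by
      rw [hfCdef, derivative_sub, derivative_X_pow, derivative_C, sub_zero,
        Nat.cast_sub (by omega : 1 ≤ p), CharP.cast_eq_zero, Nat.cast_one, zero_sub,
        show p - 1 - 1 = p - 2 by omega, C_neg, C_1, neg_one_mul]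
    have hxC : (X : C₀[X]) ^ (p - 2) * X = X ^ (p - 1) := by
      rw [← pow_succ]; congr 1; omega
    have h1C : Polynomial.C vC * Polynomial.C uC = (1 : C₀[X]) := by rw [← C_mul, hvCuC, C_1]
    let PE : StandardEtalePair C₀ :=
      ⟨fC, hfC, 1, -Polynomial.C uC * X, -Polynomial.C uC, 0, by
        rw [hderC, pow_zero]
        conv_lhs => rw [hfCdef]
        linear_combination h1C + Polynomial.C uC * hxC⟩
    haveI : Algebra.Etale C₀ (Localization.Away (AdjoinRoot.mk PE.f PE.g)) :=
      Algebra.Etale.of_equiv PE.equivAwayAdjoinRoot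
    have hunit : IsUnit (AdjoinRoot.mk PE.f PE.g) := by
      rw [show PE.g = 1 from rfl, map_one]
      exact isUnit_one
    let e1 := IsLocalization.atUnit (AdjoinRoot PE.f) (Localization.Away (AdjoinRoot.mk PE.f PE.g))
      (AdjoinRoot.mk PE.f PE.g) hunit
    exact Algebra.Etale.of_equiv (e1.restrictScalars C₀).symm
  refine ⟨alg, hIST, Algebra.Etale.of_equiv eC, fun P hP => ?_⟩
  -- lying over: `AdjoinRoot f_C` is finite free of positive rank over `C₀`
  haveI : Module.Finite C₀ (AdjoinRoot fC) := hfC.finite_adjoinRoot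
  haveI : Algebra.IsIntegral C₀ (AdjoinRoot fC) := Algebra.IsIntegral.of_finite C₀ _
  have hker : RingHom.ker (algebraMap C₀ (AdjoinRoot fC)) ≤ P := by
    rw [AdjoinRoot.algebraMap_eq, (RingHom.injective_iff_ker_eq_bot _).mp
      (AdjoinRoot.of.injective_of_degree_ne_zero ?_)]
    · exact bot_le
    · rw [hfCdef, degree_X_pow_sub_C (by omega) vC]
      exact_mod_cast (show p - 1 ≠ 0 by omega)
  obtain ⟨Q₀, -, hQ₀, hQ₀P⟩ :=
    Ideal.exists_ideal_over_prime_of_isIntegral P (⊥ : Ideal (AdjoinRoot fC))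
      (by rw [← RingHom.ker_eq_comap_bot]; exact hker)
  refine ⟨Q₀.comap (eC.symm : Z →+* AdjoinRoot fC), Ideal.comap_isPrime _ _, ?_⟩
  rw [Ideal.comap_comap, ← hQ₀P]
  congr 1
  ext c
  change eC.symm (eC (algebraMap C₀ (AdjoinRoot fC) c)) = _
  exact eC.symm_apply_apply _

open TwistedRootAlgebra in
/-- STUB `stub_twistedRootAlgebra` of the line `birth` of crux `LogCanQuotLU` (registered signature):
the twisted root algebra `S = T[ω]/(ω^{p-1} - u⁻¹)` with its `p`-cyclic derivation `θ = ω E`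
(`θ^p = θ`), whose constants `ker θ = C[ω]` form an étale `C`-algebra lying over every prime of the
ring of constants `C = T ∩ ker E`. Reduction to `twistedRootAlgebra_core` with `R := T`,
`C₀ := C`, `j` the inclusion. [cite: BerghRydh2019, Thm 5 and the definition preceding it] -/
theorem stub_twistedRootAlgebra :
    ∀ p : ℕ, p.Prime → ∀ (k K : Type) [Field k] [CharP k p] [Field K] [Algebra k K]
    (T : Subalgebra k K) (E : Derivation k K K) (u : K) (C : Subalgebra k K),
    T.FG → IsRegularRing T → (∀ x ∈ T, E x ∈ T) → u ∈ T → u⁻¹ ∈ T → u ≠ 0 →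
    (∀ x : K, (⇑E)^[p] x = u * E x) → E u = 0 →
    (∀ x : K, x ∈ C ↔ (x ∈ T ∧ E x = 0)) →
    ∃ (S : Type) (_ : CommRing S) (_ : Algebra k S), Algebra.FiniteType k S ∧ IsRegularRing S ∧
      ∃ θ : Derivation k S S, (∀ s : S, (⇑θ)^[p] s = θ s) ∧
        ∀ Z : Subalgebra k S, (∀ s : S, s ∈ Z ↔ θ s = 0) →
          ∃ (_ : Algebra C Z) (_ : IsScalarTower k C Z), Algebra.Etale C Z ∧
            ∀ P : Ideal C, P.IsPrime → ∃ Q : Ideal Z, Q.IsPrime ∧ Q.comap (algebraMap C Z) = P := by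
  intro p hp k K _ _ _ _ T E u C hTfg hTreg hpres hu huinv hu0 hmul hEu hC
  haveI : Fact p.Prime := ⟨hp⟩
  haveI : CharP K p := charP_of_injective_algebraMap (algebraMap k K).injective p
  haveI : CharP T p := CharP.subring' K p T.toSubring
  haveI : CharP C p := CharP.subring' K p C.toSubring
  haveI : Algebra.FiniteType k T := T.fg_iff_finiteType.mp hTfg
  haveI : IsRegularRing T := hTreg
  obtain ⟨ER, hER⟩ := exists_derivation_restrict T E hpres
  have hERmul : ∀ z : T, (⇑ER)^[p] z = (⟨u, hu⟩ : T) * ER z := fun z => Subtype.ext (by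
    rw [coe_iterate_restrict T E ER hER, hmul, Subalgebra.coe_mul, hER])
  have hERu : ER ⟨u, hu⟩ = 0 := Subtype.ext (by rw [hER, ZeroMemClass.coe_zero]; exact hEu)
  have huv : (⟨u, hu⟩ : T) * ⟨u⁻¹, huinv⟩ = 1 := Subtype.ext (mul_inv_cancel₀ hu0)
  have hCT : C ≤ T := fun x hx => ((hC x).1 hx).1
  have hjC : ∀ z : T, ER z = 0 ↔ z ∈ Set.range (Subalgebra.inclusion hCT) := by
    intro z
    have h1 : ER z = 0 ↔ E z = 0 := by
      rw [← hER]; exact ⟨fun h => by rw [h]; rfl, fun h => Subtype.ext h⟩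
    rw [h1]
    constructor
    · intro h
      exact ⟨⟨z, (hC z).2 ⟨z.2, h⟩⟩, rfl⟩
    · rintro ⟨c, rfl⟩
      exact ((hC c).1 c.2).2
  exact twistedRootAlgebra_core p k T ER ⟨u, hu⟩ ⟨u⁻¹, huinv⟩ huv hERmul hERu C
    (Subalgebra.inclusion hCT) (Subalgebra.inclusion_injective hCT) hjC


end Summit.ResolutionOfSingularities.ResolutionOfSingularities.Theorems

end
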